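import Summits.QuantumFields.YangMills.Theorems.UnitScaleTiltFluctuationComparisonRegPrGlobalSlackKernelLegEndToEnd
import HarnessLib

/-!
# `UnitScaleTiltFluctuationComparisonRegPrGlobalSlackKernelLegSummableT` — THE LEG SUMMABILITY WITH DOMAIN GROWTH AND STUB 3⁗ FROM THE TREE-WEIGHTED LEG ROWS
# (crux `FluctuationComparisonRegPrIntL`, stmt-QuantumFields-20520 — formerly 19935 —, STUB 3⁗ `stub_globalTwoRunSlackFam`; width-lever lane A; W-slack-2 follow-up)

Seat ym-ust-19935-slack g2 (prover).  `…KernelLegEndToEnd.LegSummable dist κ₂ S` asks `Σ_c e^{−κ₂ d(c)} ≤ S` UNIFORMLY in the domain — print's (43)/(45) case of a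
ONE-BLOCK anchor `y`.  The new terms of the canonical polymerisation are anchored at multi-block domains `X` (retained `tsys`-domains of (59)); for a leg
distance measured from the domain the sum grows like the number of blocks of `X`, i.e. like `1 + 𝓛(X)` (LQB's printed lower half of (2.30): `#X ≤ 2^d(4·d(X) + 1)`,
`TreeLengthTorus.card_le_torusTreeLen`).  This file types the honest row and shows that the growth is paid by an `ε` of the kernels' tree decay — which the
constants record affords (`AlphaConsts.kappa_ge : κ₀(32,6) + 1 ≤ 𝔠.κ`, so `κ := 𝔠.κ − ½` is still admissible for the cover row):

* §1 `LegSummableT D dist κ₂ S` (`Σ_c e^{−κ₂ d(c)} ≤ S·(1 + 𝓛(Y))` on the listed domains); `one_add_pow_six_le` (`(1 + x)⁶ ≤ (6/ε)⁶·e^{εx}`);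
  **`kernelLegΦ_of_pointwise_T`**: (43) pointwise + `LegSummableT` ⟹ `KernelLegΦ … κ′ (κ − ε) (A·S⁶·(6/ε)⁶)` (tree lengths nonnegative);
* §2 decay monotonicity of the leg rows (`flatKernelLegCauchyΦ_mono`, `kernelLegΦ_mono`, `remainderSmallΦ_mono`);
* §3 **`K1aLegRowsT L 𝔠 a₀ a₁ a`** (= `K1aLegRowsP` with `LegSummableT` in place of `LegSummable`), **`k1aChartRowsC_of_legRowsT`** (`κ := 𝔠.κ − ½`),
  **`globalTwoRunSlackFam_of_k1aLegRowsT : (∀ L …, ∃ a, 0 < a ∧ a < 1 ∧ K1aLegRowsT L 𝔠 a₀ a₁ a) → ⟨THE REGISTERED TEXT OF stub_globalTwoRunSlackFam⟩`**.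
The companion files `…KernelLegGeometry`/`…KernelLegGeometrySum` discharge `DistNonneg`, `DistMatched`, `LegSummableT` for a CONCRETE leg distance on `canonPolymer`.
Every `def … : Prop` is a hypothesis schema (never asserted); nothing of [Balaban1985UV3]/[King1986] is asserted.

References: T. Bałaban, CMP 102 (1985) 255–275 [Balaban1985UV3] ((43)–(46) pp.266–267, (59) p.270); CMP 116 (1988) 1–22 [Balaban1988RG2Cluster] ((2.30) p.18);
C. King, CMP 102 (1986) 649–677 [King1986] (Thm 3.4 (3.9) p.656, Prop. 3.6 (3.56) p.662).
-/

set_option autoImplicit false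

noncomputable section

open scoped BigOperators
open Literature.MathematicalPhysics.QuantumFieldTheory.Balaban1983to89
open Literature.MathematicalPhysics.QuantumFieldTheory.Balaban1983to89.T3ContinuumYM3Torus
open Literature.MathematicalPhysics.QuantumFieldTheory.Balaban1983to89.T3UnitScaleTilt
open Literature.MathematicalPhysics.QuantumFieldTheory.Balaban1983to89.T3LevelShift
open Literature.MathematicalPhysics.QuantumFieldTheory.Balaban1983to89.T3AlphaInputsAC
open Literature.MathematicalPhysics.QuantumFieldTheory.Balaban1983to89.T3AlphaPolymerSocket
open Literature.MathematicalPhysics.QuantumFieldTheory.Balaban1983to89.T3AlphaInputsACTwoRun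
open Literature.MathematicalPhysics.QuantumFieldTheory.Balaban1983to89.T3AlphaInputsACTwoRunLevel
open Literature.MathematicalPhysics.QuantumFieldTheory.Balaban1983to89.B12TreeDecay (kappa₀ kappa₀_nonneg)
open Summit.QuantumFields.Balaban3D.Carriers
open Summit.QuantumFields.Balaban3D.Proofs.Primitives
open Summit.QuantumFields.Balaban3D.Proofs.GroupModelLieC (lieC)
open Summit.QuantumFields.YangMills.Theorems
open Summit.QuantumFields.YangMills.Theorems.GlobalSlackKernelMatching
open Summit.QuantumFields.YangMills.Theorems.GlobalSlackCanonicalPolymers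

namespace Summit.QuantumFields.YangMills.Theorems.GlobalSlackKernelLeg

variable {𝕍 : Type} [NormedAddCommGroup 𝕍] [NormedSpace ℂ 𝕍] {F : T3Family} {γ : ℝ}

/-! ## §1 Leg summability with domain growth -/

omit [NormedAddCommGroup 𝕍] [NormedSpace ℂ 𝕍] in
/-- **LEG SUMMABILITY WITH DOMAIN GROWTH** (hypothesis schema, never asserted; lattice geometry of `π`): on every LISTED domain `Y` (term level `1+b`),
`Σ_c e^{−κ₂ d(c)} ≤ S·(1 + 𝓛(Y))` — the bonds at distance `∼ r` from a block number `O(r²)`, and a domain has `O(1 + 𝓛)` blocks ((45) p.267; (2.30) p.18).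
[cite: Balaban1985UV3, (45) p.267] -/
def LegSummableT (D : AlphaDataT3 F γ) (dist : LegDist F) (κ₂ S : ℝ) : Prop :=
  ∀ (K k b : ℕ) (Y : Set (Site (F.P K) 0)), Y ∈ D.Loc K k (D.triv K k) (1 + b) →
    ∑ c : PBond (F.P K) b, Real.exp (-(κ₂ * dist K b Y c)) ≤ S * (1 + D.treeLen K (1 + b) Y)

omit [NormedAddCommGroup 𝕍] [NormedSpace ℂ 𝕍] in
/-- The uniform summability is the growth-free case (`1 ≤ 1 + 𝓛` for nonnegative tree lengths). [cite: Balaban1985UV3, (45) p.267] -/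
theorem legSummableT_of_legSummable {D : AlphaDataT3 F γ} {dist : LegDist F} {κ₂ S : ℝ} (hS : 0 ≤ S) (hT : ∀ K i Y, 0 ≤ D.treeLen K i Y)
    (h : LegSummable dist κ₂ S) : LegSummableT D dist κ₂ S := by
  intro K k b Y _
  refine (h K b Y).trans ?_
  have := hT K (1 + b) Y
  nlinarith

omit [NormedAddCommGroup 𝕍] [NormedSpace ℂ 𝕍] in
/-- **`(1 + x)⁶ ≤ (6/ε)⁶·e^{εx}`** for `x ≥ 0`, `0 < ε ≤ 6` (the polynomial domain growth is paid by an `ε` of tree decay). [folklore] -/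
theorem one_add_pow_six_le {ε x : ℝ} (hε : 0 < ε) (hε6 : ε ≤ 6) (hx : 0 ≤ x) : (1 + x) ^ 6 ≤ (6 / ε) ^ 6 * Real.exp (ε * x) := by
  have h1 : 1 + x ≤ 6 / ε * (1 + ε * x / 6) := by
    rw [mul_add, mul_one, show 6 / ε * (ε * x / 6) = x by field_simp]
    have : 1 ≤ 6 / ε := by rw [le_div_iff₀ hε]; linarith
    linarith
  have h2 : 1 + ε * x / 6 ≤ Real.exp (ε * x / 6) := by
    have := Real.add_one_le_exp (ε * x / 6); linarith
  have h3 : 0 ≤ 1 + ε * x / 6 := by positivity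
  calc (1 + x) ^ 6 ≤ (6 / ε * (1 + ε * x / 6)) ^ 6 := pow_le_pow_left₀ (by positivity) h1 6
    _ = (6 / ε) ^ 6 * (1 + ε * x / 6) ^ 6 := mul_pow _ _ 6
    _ ≤ (6 / ε) ^ 6 * Real.exp (ε * x / 6) ^ 6 := mul_le_mul_of_nonneg_left (pow_le_pow_left₀ h3 h2 6) (by positivity)
    _ = (6 / ε) ^ 6 * Real.exp (ε * x) := by rw [← Real.exp_nat_mul]; ring_nf

/-- **THE WEIGHTED KERNEL SIZE FROM THE POINTWISE (43) ROW AND THE GROWTH SUMMABILITY**: for weights `κ′` with `κ′ + κ₂ ≤ κ₁`, nonnegative distances and tree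
lengths, `1 ≤ S` and `0 < ε ≤ 6`: `KernelLegPointwiseΦ … κ₁ κ A ∧ LegSummableT … κ₂ S ⟹ KernelLegΦ … κ′ (κ − ε) (A·S⁶·(6/ε)⁶)` — (45)'s mechanism with the
domain's block count paid by `e^{ε𝓛}`. [cite: Balaban1985UV3, (43) p.266, (45) p.267] -/
theorem kernelLegΦ_of_pointwise_T {D : AlphaDataT3 F γ} {Φ : ChartFam 𝕍 F} {dist : LegDist F} {κ₁ κ₂ κ' κ A S ε : ℝ}
    (hn : DistNonneg dist) (hT : ∀ K i Y, 0 ≤ D.treeLen K i Y) (hκ : κ' + κ₂ ≤ κ₁) (hA : 0 ≤ A) (hS : 1 ≤ S) (hε : 0 < ε) (hε6 : ε ≤ 6)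
    (hP : KernelLegPointwiseΦ D Φ dist κ₁ κ A) (hsum : LegSummableT D dist κ₂ S) :
    KernelLegΦ D Φ dist κ' (κ - ε) (A * S ^ 6 * (6 / ε) ^ 6) := by
  classical
  intro K k b Y hY d hd
  have hd6 : d ≤ 6 := by have := (Finset.mem_Ico.mp hd).2; omega
  set T := D.treeLen K (1 + b) Y with hTdef
  have hT0 : 0 ≤ T := hT K (1 + b) Y
  have hAe : 0 ≤ A * Real.exp (-κ * T) := mul_nonneg hA (Real.exp_pos _).le
  have hleg := opNorm_compDiag_le_of_legs (ker Φ K b Y d) (legW dist κ' K b Y) (legW_ne_zero dist κ' K b Y) hAe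
    (fun c => Real.exp (-(κ₁ * dist K b Y c))) (fun c => (Real.exp_pos _).le) (fun c v => hP K k b Y hY d hd c v)
  refine hleg.trans ?_
  have hsumle : ∑ c : PBond (F.P K) b, ‖legW dist κ' K b Y c‖ * Real.exp (-(κ₁ * dist K b Y c)) ≤ S * (1 + T) := by
    refine (Finset.sum_le_sum fun c _ => ?_).trans (hsum K k b Y hY)
    rw [norm_legW, ← Real.exp_add, Real.exp_le_exp]
    have := hn K b Y c
    nlinarith
  have hsum0 : 0 ≤ ∑ c : PBond (F.P K) b, ‖legW dist κ' K b Y c‖ * Real.exp (-(κ₁ * dist K b Y c)) :=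
    Finset.sum_nonneg fun c _ => mul_nonneg (norm_nonneg _) (Real.exp_pos _).le
  have hS0 : 0 ≤ S := zero_le_one.trans hS
  have hST1 : 1 ≤ S * (1 + T) := by nlinarith
  have hpoly := one_add_pow_six_le hε hε6 hT0
  calc A * Real.exp (-κ * T) * (∑ c, ‖legW dist κ' K b Y c‖ * Real.exp (-(κ₁ * dist K b Y c))) ^ d
      ≤ A * Real.exp (-κ * T) * (S * (1 + T)) ^ d := mul_le_mul_of_nonneg_left (pow_le_pow_left₀ hsum0 hsumle d) hAe
    _ ≤ A * Real.exp (-κ * T) * (S * (1 + T)) ^ 6 := mul_le_mul_of_nonneg_left (pow_le_pow_right₀ hST1 hd6) hAe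
    _ = A * Real.exp (-κ * T) * S ^ 6 * (1 + T) ^ 6 := by rw [mul_pow]; ring
    _ ≤ A * Real.exp (-κ * T) * S ^ 6 * ((6 / ε) ^ 6 * Real.exp (ε * T)) := mul_le_mul_of_nonneg_left hpoly (by positivity)
    _ = A * S ^ 6 * (6 / ε) ^ 6 * (Real.exp (-κ * T) * Real.exp (ε * T)) := by ring
    _ = A * S ^ 6 * (6 / ε) ^ 6 * Real.exp (-(κ - ε) * T) := by rw [← Real.exp_add]; ring_nf

/-! ## §2 Decay monotonicity of the rows (nonnegative tree lengths) -/

/-- `FlatKernelLegCauchyΦ` is monotone in the tree decay. [folklore] -/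
theorem flatKernelLegCauchyΦ_mono {D : AlphaDataT3 F γ} {Φ : ChartFam 𝕍 F} {dist : LegDist F} {κw κ κ' a C : ℝ} (hT : ∀ K i Y, 0 ≤ D.treeLen K i Y)
    (hκ : κ' ≤ κ) (hC : 0 ≤ C) (h : FlatKernelLegCauchyΦ D Φ dist κw κ a C) : FlatKernelLegCauchyΦ D Φ dist κw κ' a C := by
  intro K k b Y hY d hd
  refine (h K k b Y hY d hd).trans ?_
  have hρ : 0 ≤ (((F.L : ℝ) ^ (1 + b))⁻¹) ^ a := Real.rpow_nonneg (by positivity) _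
  exact mul_le_mul_of_nonneg_right (mul_le_mul_of_nonneg_left (Real.exp_le_exp.mpr (by nlinarith [hT K (1 + b) Y])) hC) hρ

/-- `KernelLegΦ` is monotone in the tree decay. [folklore] -/
theorem kernelLegΦ_mono {D : AlphaDataT3 F γ} {Φ : ChartFam 𝕍 F} {dist : LegDist F} {κw κ κ' C_E : ℝ} (hT : ∀ K i Y, 0 ≤ D.treeLen K i Y)
    (hκ : κ' ≤ κ) (hC : 0 ≤ C_E) (h : KernelLegΦ D Φ dist κw κ C_E) : KernelLegΦ D Φ dist κw κ' C_E := fun K k b Y hY d hd =>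
  (h K k b Y hY d hd).trans (mul_le_mul_of_nonneg_left (Real.exp_le_exp.mpr (by nlinarith [hT K (1 + b) Y])) hC)

omit [NormedAddCommGroup 𝕍] [NormedSpace ℂ 𝕍] in
/-- `RemainderSmallΦ` is monotone in the tree decay. [folklore] -/
theorem remainderSmallΦ_mono {D : AlphaDataT3 F γ} {R : RemFam F} {b₀ p₀ κ κ' C_R : ℝ} (hT : ∀ K i Y, 0 ≤ D.treeLen K i Y)
    (hθ : ∀ n, 0 ≤ θBal F.L γ b₀ p₀ n) (hκ : κ' ≤ κ) (hC : 0 ≤ C_R) (h : RemainderSmallΦ D R b₀ p₀ κ C_R) : RemainderSmallΦ D R b₀ p₀ κ' C_R := by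
  intro K n hn j hj V hV Y hY
  obtain ⟨h1, h2⟩ := h K n hn j hj V hV Y hY
  have hfac : C_R * Real.exp (-κ * D.treeLen K (1 + j) Y) * θBal F.L γ b₀ p₀ n ^ 7 * (((F.L : ℝ) ^ (K - n - 1 - j))⁻¹) ^ 4 ≤
      C_R * Real.exp (-κ' * D.treeLen K (1 + j) Y) * θBal F.L γ b₀ p₀ n ^ 7 * (((F.L : ℝ) ^ (K - n - 1 - j))⁻¹) ^ 4 :=
    mul_le_mul_of_nonneg_right (mul_le_mul_of_nonneg_right
      (mul_le_mul_of_nonneg_left (Real.exp_le_exp.mpr (by nlinarith [hT K (1 + j) Y])) hC) (pow_nonneg (hθ n) 7)) (by positivity)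
  exact ⟨h1.trans hfac, h2.trans hfac⟩

/-! ## §3 The tree-weighted leg rows and the registered stub -/

/-- **THE K1a LEG ROWS, POINTWISE FORM WITH GROWTH SUMMABILITY** (hypothesis schema, never asserted): `K1aLegRowsP` with `LegSummable` replaced by `LegSummableT`
(the domain-anchored honest form for the canonical polymerisation's multi-block new-term domains). [cite: Balaban1985UV3, (43)-(46) pp.266-267; King1986, Prop. 3.6 (3.56) p.662] -/
def K1aLegRowsT (L : ℕ) (𝔠 : AlphaConsts L (suGroupModel 2).N) (a₀ a₁ a : ℝ) : Prop :=
  ∃ (κ' κ₁ S C A C_R C_s C_B γB : ℝ), 0 < κ' ∧ κ' < κ₁ ∧ 1 ≤ S ∧ 0 ≤ C ∧ 0 ≤ A ∧ 0 ≤ C_R ∧ 0 ≤ C_s ∧ 0 ≤ C_B ∧ 0 < γB ∧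
    ∀ (F : T3Family) (γ : ℝ) (hF : F.L = L) (hγ : 0 < γ), γ ≤ γB → ∀ (hγ1 : γ ≤ (min (hF ▸ 𝔠).gamma0 1) ^ 2),
      AlphaInputsT3AC.OfV3At F (hF ▸ 𝔠) a₀ a₁ →
        ∃ (p : ∀ K, AlphaInputsT3AC.PkgAtV3 F (hF ▸ 𝔠) γ hγ hγ1 K), (∀ K, (p K).a₀ = a₀ ∧ (p K).a₁ = a₁) ∧
          ∃ (dist : LegDist F) (Φ : ChartFam ↥(lieC (suGroupModel 2)) F) (e : VacFam F) (B : CfgFam ↥(lieC (suGroupModel 2)) F) (R : RemFam F),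
            DistNonneg dist ∧ DistMatched dist ∧ LegSummableT (AlphaInputsT3AC.dataOfV3 p (canonPolymer p)) dist (κ₁ - κ') S ∧
            TaylorSplitΦ (canonPT p) Φ e B R ∧
            FlatKernelLegCauchyΦ (AlphaInputsT3AC.dataOfV3 p (canonPolymer p)) Φ dist κ' (hF ▸ 𝔠).κ a C ∧
            KernelLegPointwiseΦ (AlphaInputsT3AC.dataOfV3 p (canonPolymer p)) Φ dist κ₁ (hF ▸ 𝔠).κ A ∧
            RemainderSmallΦ (AlphaInputsT3AC.dataOfV3 p (canonPolymer p)) R (hF ▸ 𝔠).b₀ (hF ▸ 𝔠).p₀ (hF ▸ 𝔠).κ C_R ∧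
            CfgDistΦ (AlphaInputsT3AC.dataOfV3 p (canonPolymer p)) B dist (hF ▸ 𝔠).b₀ (hF ▸ 𝔠).p₀ C_s ∧
            CfgDistCauchyΦ (AlphaInputsT3AC.dataOfV3 p (canonPolymer p)) B dist (hF ▸ 𝔠).b₀ (hF ▸ 𝔠).p₀ a C_B

/-- **THE TREE-WEIGHTED LEG ROWS GIVE THE LETTER-FREE CHART ROWS at `κ := 𝔠.κ − ½`** (admissible by `AlphaConsts.kappa_ge`; the half unit of tree decay pays the
domain growth, `ε = ½`), through the rescaled pair `(Φ∘D_w, D_w⁻¹B)`. [cite: Balaban1985UV3, (43)-(45) pp.266-267; Balaban1987RG1, (0.26) p.257] -/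
theorem k1aChartRowsC_of_legRowsT {L : ℕ} {𝔠 : AlphaConsts L (suGroupModel 2).N} {a₀ a₁ a : ℝ} (h : K1aLegRowsT L 𝔠 a₀ a₁ a) :
    K1aChartRowsC L 𝔠 a₀ a₁ a := by
  obtain ⟨κ', κ₁, S, C, A, C_R, C_s, C_B, γB, hκ', hκ1, hS, hC, hA, hCR, hCs, hCB, hγB, hall⟩ := h
  have hk1 : 0 ≤ 1 + κ'⁻¹ := by positivity
  -- the record's decay budget: `κ₀(32,6) + 1 ≤ 𝔠.κ` (the atom `kappa₀ …` is named before `linarith` sees the numerals)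
  have hκhalf : kappa₀ (4 * 2 ^ 3) (2 * 3) ≤ 𝔠.κ - 1 / 2 ∧ 0 < 𝔠.κ - 1 / 2 := by
    have hge := 𝔠.kappa_ge
    have h0 : 0 ≤ kappa₀ (4 * 2 ^ 3) (2 * 3) := kappa₀_nonneg (by norm_num) _
    set k := kappa₀ (4 * 2 ^ 3) (2 * 3) with hk
    constructor <;> linarith
  set C_E : ℝ := A * S ^ 6 * (6 / (1 / 2 : ℝ)) ^ 6 with hCE
  have hCE0 : 0 ≤ C_E := by rw [hCE]; have := zero_le_one.trans hS; positivity
  refine ⟨𝔠.κ - 1 / 2, C, C_E, C_R, C_s * (1 + κ'⁻¹), C_B * (1 + κ'⁻¹), γB, hκhalf.2, by linarith, hκhalf.1, hC, hCE0, hCR,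
    mul_nonneg hCs hk1, mul_nonneg hCB hk1, hγB, fun F γ hF hγ hγle hγ1 hOf => ?_⟩
  subst hF
  obtain ⟨p, hp, dist, Φ, e, B, R, hn, hm, hsum, hT, hK, hP, hR, hSz, hBC⟩ := hall F γ rfl hγ hγle hγ1 hOf
  have hL : 1 ≤ F.L := F.hL.2.le
  have hγ1' : γ ≤ 1 := hγ1.trans (sq_min_one_le _ 𝔠.gamma0_pos)
  have hTl : ∀ K i Y, 0 ≤ (AlphaInputsT3AC.dataOfV3 p (canonPolymer p)).treeLen K i Y := fun K i Y => canonTreeLen_nonneg p K i Y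
  have hθ : ∀ n, 0 ≤ θBal F.L γ 𝔠.b₀ 𝔠.p₀ n := fun n => (T3MinimiserStabilityReduction.θBal_pos hL hγ hγ1' 𝔠.b₀_pos 𝔠.p₀ n).le
  have hE : KernelLegΦ (AlphaInputsT3AC.dataOfV3 p (canonPolymer p)) Φ dist κ' (𝔠.κ - 1 / 2) C_E :=
    kernelLegΦ_of_pointwise_T hn hTl (by linarith) hA hS (by norm_num) (by norm_num) hP hsum
  have hK' := flatKernelLegCauchyΦ_mono hTl (show 𝔠.κ - 1 / 2 ≤ 𝔠.κ by linarith) hC hK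
  have hR' := remainderSmallΦ_mono hTl hθ (show 𝔠.κ - 1 / 2 ≤ 𝔠.κ by linarith) hCR hR
  exact ⟨p, hp, rescaleΦw dist κ' Φ, e, rescaleBw dist κ' B, R, taylorSplitΦ_rescaleW dist κ' hT, flatKernelCauchyΦ_rescaleW hm hK',
    kernelSizeΦ_rescaleW hE, hR', cfgSizeΦ_rescaleW hL hγ hγ1' 𝔠.b₀_pos hn hm hκ' hCs hSz, cfgCauchyΦ_rescaleW hL hγ hγ1' 𝔠.b₀_pos hn hm hκ' hCB hBC⟩

/-- **THE REGISTERED STUB 3⁗ FROM THE TREE-WEIGHTED LEG ROWS, BY NAME** (`globalTwoRunSlackFam_of_k1aChartRowsC ∘ k1aChartRowsC_of_legRowsT`).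
[cite: King1986, Thm 3.4 (3.9) p.656, Prop. 3.6 p.662; Balaban1985UV3, (43)-(46) pp.266-267, (57) p.270] -/
theorem globalTwoRunSlackFam_of_k1aLegRowsT
    (h : ∀ (L : ℕ), Odd L → 7 ≤ L → ∀ (𝔠 : AlphaConsts L (suGroupModel 2).N) (a₀ a₁ : ℝ), 0 < a₀ → 0 < a₁ → 𝔠.B₃ * a₁ ≤ a₀ →
      ∃ a : ℝ, 0 < a ∧ a < 1 ∧ K1aLegRowsT L 𝔠 a₀ a₁ a) :
    ∀ (L : ℕ), Odd L → 7 ≤ L → ∀ (𝔠 : Summit.QuantumFields.Balaban3D.Proofs.Primitives.AlphaConsts L (Summit.QuantumFields.Balaban3D.Carriers.suGroupModel 2).N)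
      (a₀ a₁ : ℝ), 0 < a₀ → 0 < a₁ → 𝔠.B₃ * a₁ ≤ a₀ →
      ∃ a : ℝ, 0 < a ∧ ∃ γB : ℝ, 0 < γB ∧ ∀ (F : T3Family) (γ : ℝ) (hF : F.L = L) (hγ : 0 < γ), γ ≤ γB →
        ∀ (hγ1 : γ ≤ (min (hF ▸ 𝔠).gamma0 1) ^ 2),
          Summit.QuantumFields.YangMills.Theorems.AlphaInputsT3AC.OfV3At F (hF ▸ 𝔠) a₀ a₁ →
          ∃ (p : ∀ K, Summit.QuantumFields.YangMills.Theorems.AlphaInputsT3AC.PkgAtV3 F (hF ▸ 𝔠) γ hγ hγ1 K),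
            (∀ K, (p K).a₀ = a₀ ∧ (p K).a₁ = a₁) ∧
            ∃ (π : Summit.QuantumFields.YangMills.Theorems.AlphaInputsT3AC.PolymerT3 F) (σ : ℕ) (C : ℝ), 7 ≤ σ ∧ 0 ≤ C ∧
              Summit.QuantumFields.YangMills.Theorems.GlobalSlack.GlobalSupRateTSlack (Summit.QuantumFields.YangMills.Theorems.AlphaInputsT3AC.dataOfV3 p π) (hF ▸ 𝔠).b₀ (hF ▸ 𝔠).p₀ a σ C :=
  globalTwoRunSlackFam_of_k1aChartRowsC fun L hLo h7 𝔠 a₀ a₁ ha0 ha1 hw => by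
    obtain ⟨a, ha, ha1', hc⟩ := h L hLo h7 𝔠 a₀ a₁ ha0 ha1 hw
    exact ⟨a, ha, ha1', k1aChartRowsC_of_legRowsT hc⟩

end Summit.QuantumFields.YangMills.Theorems.GlobalSlackKernelLeg

end
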